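import Summits.ValiantsHypothesis.ValiantsHypothesis.Theorems.FeketeSOSFeketeSOSHardPaleyRIPFlatRIPPolarisation
import Mathlib.Analysis.SpecialFunctions.Pow.Real

/-!
# Route FeketeSOS — crux `FeketeSOSHard` (stmt-ValiantsHypothesis-3996), line `paley-rip`,
# stub `stub_paleyFlatRIP`: what the engine implies (flat discrepancy beyond `√p`; rung R4)

The engine `stub_paleyFlatRIP` of the line of record `Cruxes/FeketeSOSHard/Lines/paley_rip.lean`
(restricted flatness of the Paley–Hankel matrix `(χ_p(a+b))` on supports `#S ≤ p^{1/2+δ₁}`, i.e. PaleyRIP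
beyond the square-root bottleneck; Bandeira–Mixon–Moreira 2017 Def. 2.1, Chung 1994 Conj. 2.2) is OPEN.
Taking its registered statement VERBATIM as a hypothesis, this file records two consequences that place
it in the literature:

* `paleySumDiscrepancy_of_flatRIP` — FLAT RESTRICTED DISCREPANCY of the Paley sum graph beyond `√p`:
  `|Σ_{a∈A,b∈B} χ_p(a+b)| ≤ p^{1/2−κ} √(#A·#B)` for all large `p` and all `A, B ⊆ [0,p)` of size
  `≤ p^{1/2+δ₁/2}` (Chung-type discrepancy; completion / expander mixing gives only `√p·√(#A#B)`).
  Proof: polarisation on `S = A ∪ B` (`norm_charSum_le_of_quad`).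
* `sumClique_card_le_of_flatRIP` — the line card's rung R4: every Paley SUM-clique `Q ⊆ [0,p)`
  (`χ_p(a+b) = 1` for `a ≠ b ∈ Q`) has `#Q ≤ p^{1/2−κ} + 2` for all large `p`; unconditionally only the
  square-root scale is known (Hanson–Petridis for difference cliques; completion for sum-cliques), so the
  engine is a statement of Paley-graph-conjecture class.  Proof: test `w = 1` on `Q` or on a
  `⌊p^{1/2+δ₁}⌋`-subset of it: `#Q² − 2#Q ≤ |Q_p(Q,1)| ≤ p^{1/2−κ}·#Q`.

Honest framing: consequences of the OPEN engine (hypothesis `hB` below is the stub, not a theorem), landed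
`--supports` the crux item; the crux `FeketeSOSHard`, the engine and `stub_tameReduction` remain open;
nothing here bears on `VP ≠ VNP`.
-/

-- the line's namespace repeats a path segment by convention (same as the other paley-rip files)
set_option linter.dupNamespace false

namespace Summit.ValiantsHypothesis.ValiantsHypothesis.Theorems.FeketeSOSHardPaleyRIP

open Finset
open scoped BigOperators

noncomputable section

section Consequences

/-- A Legendre symbol is at least `−1`. [folklore] -/
theorem neg_one_le_legendreSym (p : ℕ) [Fact p.Prime] (x : ℤ) : (-1 : ℤ) ≤ legendreSym p x := by
  rcases (quadraticChar_isQuadratic (ZMod p)) (x : ZMod p) with h | h | h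
  · have h' : legendreSym p x = 0 := h
    omega
  · have h' : legendreSym p x = 1 := h
    omega
  · have h' : legendreSym p x = -1 := h
    omega


/-- **The engine implies flat restricted discrepancy of the Paley sum graph beyond `√p`**
(Chung-type discrepancy, cf. Chung 1994 Conj. 2.2 and Bandeira–Mixon–Moreira 2017 §2): from
`stub_paleyFlatRIP` (taken here as a hypothesis, verbatim) one gets `κ, δ > 0` with
`|Σ_{a∈A,b∈B} χ_p(a+b)| ≤ p^{1/2−κ} √(#A·#B)` for all large primes `p` and all `A, B ⊆ [0,p)` with
`#A, #B ≤ p^{1/2+δ}` (proof: polarisation on `S = A ∪ B`, with `δ = δ₁/2`).  The expander-mixing /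
completion bound gives only `√p · √(#A·#B)`. [folklore] -/
theorem paleySumDiscrepancy_of_flatRIP
    (hB : ∃ κ : ℝ, 0 < κ ∧ ∃ δ₁ : ℝ, 0 < δ₁ ∧ ∃ p₁ : ℕ, ∀ (p : ℕ) [Fact p.Prime], p₁ ≤ p →
      ∀ (S : Finset ℕ), (∀ a ∈ S, a < p) → (S.card : ℝ) ≤ (p : ℝ) ^ (1 / 2 + δ₁) →
      ∀ (w : ℕ → ℂ), ‖paleyForm p S w‖ ≤ (p : ℝ) ^ (1 / 2 - κ) * ∑ a ∈ S, ‖w a‖ ^ 2) :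
    ∃ κ : ℝ, 0 < κ ∧ ∃ δ : ℝ, 0 < δ ∧ ∃ p₁ : ℕ, ∀ (p : ℕ) [Fact p.Prime], p₁ ≤ p →
      ∀ (A B : Finset ℕ), (∀ a ∈ A, a < p) → (∀ b ∈ B, b < p) →
        (A.card : ℝ) ≤ (p : ℝ) ^ (1 / 2 + δ) → (B.card : ℝ) ≤ (p : ℝ) ^ (1 / 2 + δ) →
        ‖∑ a ∈ A, ∑ b ∈ B, ((legendreSym p ((a : ℤ) + b) : ℤ) : ℂ)‖ ≤
          (p : ℝ) ^ (1 / 2 - κ) * Real.sqrt ((A.card : ℝ) * B.card) := by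
  classical
  obtain ⟨κ, hκ, δ₁, hδ₁, p₁, hB⟩ := hB
  -- `N` with `p ≥ N ⇒ p^{δ₁/2} ≥ 2`
  obtain ⟨N, hN⟩ : ∃ N : ℕ, (2 : ℝ) ^ (1 / (δ₁ / 2)) ≤ (N : ℝ) := ⟨_, Nat.le_ceil _⟩
  refine ⟨κ, hκ, δ₁ / 2, by linarith, max p₁ N, ?_⟩
  intro p _ hp A B hA hBp hAc hBc
  have hprime : p.Prime := Fact.out
  have hp0 : (0 : ℝ) < (p : ℝ) := by exact_mod_cast hprime.pos
  have hp₁ : p₁ ≤ p := le_trans (le_max_left _ _) hp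
  have hpN : (N : ℝ) ≤ (p : ℝ) := by exact_mod_cast le_trans (le_max_right _ _) hp
  have h2 : (2 : ℝ) ≤ (p : ℝ) ^ (δ₁ / 2) := by
    have h0 : (0 : ℝ) ≤ (2 : ℝ) ^ (1 / (δ₁ / 2)) := Real.rpow_nonneg (by norm_num) _
    calc (2 : ℝ) = ((2 : ℝ) ^ (1 / (δ₁ / 2))) ^ (δ₁ / 2) := by
          rw [one_div, Real.rpow_inv_rpow (by norm_num) (by positivity)]
      _ ≤ (p : ℝ) ^ (δ₁ / 2) := Real.rpow_le_rpow h0 (hN.trans hpN) (by positivity)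
  -- the union `S = A ∪ B` is admissible for the engine
  set S : Finset ℕ := A ∪ B with hSdef
  have hS : ∀ a ∈ S, a < p := by
    intro a ha
    rcases mem_union.1 ha with h | h
    · exact hA a h
    · exact hBp a h
  have hScard : (S.card : ℝ) ≤ (p : ℝ) ^ (1 / 2 + δ₁) := by
    have h1 : (S.card : ℝ) ≤ (A.card : ℝ) + B.card := by exact_mod_cast card_union_le A B
    have h3 : (p : ℝ) ^ (1 / 2 + δ₁) = (p : ℝ) ^ (1 / 2 + δ₁ / 2) * (p : ℝ) ^ (δ₁ / 2) := by
      rw [← Real.rpow_add hp0]; ring_nf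
    rw [h3]
    have h4 : 0 ≤ (p : ℝ) ^ (1 / 2 + δ₁ / 2) := Real.rpow_nonneg hp0.le _
    nlinarith
  have hQ : ∀ w : ℕ → ℂ, ‖paleyForm p S w‖ ≤ (p : ℝ) ^ (1 / 2 - κ) * ∑ a ∈ S, ‖w a‖ ^ 2 :=
    fun w => hB p hp₁ S hS hScard w
  exact norm_charSum_le_of_quad p _ S hQ A B subset_union_left subset_union_right

/-- The character sum over a Paley SUM-clique `Q` (`χ_p(a+b) = 1` for `a ≠ b ∈ Q`) is at least
`#Q² − 2#Q` (off-diagonal terms are `1`, diagonal terms `χ_p(2a) ≥ −1`). [folklore] -/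
theorem sumClique_charSum_ge (p : ℕ) [Fact p.Prime] (Q : Finset ℕ)
    (hQ : ∀ a ∈ Q, ∀ b ∈ Q, a ≠ b → legendreSym p ((a : ℤ) + b) = 1) :
    ((Q.card : ℤ) ^ 2 - 2 * Q.card) ≤ ∑ a ∈ Q, ∑ b ∈ Q, legendreSym p ((a : ℤ) + b) := by
  classical
  have hrow : ∀ a ∈ Q, ((Q.card : ℤ) - 2) ≤ ∑ b ∈ Q, legendreSym p ((a : ℤ) + b) := by
    intro a ha
    rw [← add_sum_erase Q (fun b => legendreSym p ((a : ℤ) + b)) ha]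
    have hoff : ∑ b ∈ Q.erase a, legendreSym p ((a : ℤ) + b) = ((Q.erase a).card : ℤ) := by
      rw [sum_congr rfl (fun b hb => hQ a ha b (mem_of_mem_erase hb) (ne_of_mem_erase hb).symm)]
      simp
    rw [hoff, card_erase_of_mem ha]
    have hdiag := neg_one_le_legendreSym p ((a : ℤ) + a)
    have hc : 1 ≤ Q.card := card_pos.2 ⟨a, ha⟩
    push_cast [Nat.cast_sub hc]
    linarith
  calc ((Q.card : ℤ) ^ 2 - 2 * Q.card) = ∑ a ∈ Q, ((Q.card : ℤ) - 2) := by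
        rw [sum_const, nsmul_eq_mul]; ring
    _ ≤ ∑ a ∈ Q, ∑ b ∈ Q, legendreSym p ((a : ℤ) + b) := sum_le_sum hrow

/-- **Rung R4 of the line card: the engine bounds Paley sum-cliques below `√p`.**  From
`stub_paleyFlatRIP` (as a hypothesis, verbatim): `∃ κ > 0 ∃ p₁ ∀ p ≥ p₁` prime, every `Q ⊆ [0,p)` with
`χ_p(a+b) = 1` for all `a ≠ b` in `Q` has `#Q ≤ p^{1/2−κ} + 2`.  (Known unconditionally only at the
square-root scale — Hanson–Petridis for difference cliques, completion `√p + O(1)` for sum-cliques — so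
the engine is a statement of Paley-graph-conjecture class.)  Proof: test `w = 1` on `Q` (or on a
`⌊p^{1/2+δ₁}⌋`-subset of it): `#Q² − 2#Q ≤ |Q_p(Q,1)| ≤ p^{1/2−κ} #Q`. [folklore] -/
theorem sumClique_card_le_of_flatRIP
    (hB : ∃ κ : ℝ, 0 < κ ∧ ∃ δ₁ : ℝ, 0 < δ₁ ∧ ∃ p₁ : ℕ, ∀ (p : ℕ) [Fact p.Prime], p₁ ≤ p →
      ∀ (S : Finset ℕ), (∀ a ∈ S, a < p) → (S.card : ℝ) ≤ (p : ℝ) ^ (1 / 2 + δ₁) →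
      ∀ (w : ℕ → ℂ), ‖paleyForm p S w‖ ≤ (p : ℝ) ^ (1 / 2 - κ) * ∑ a ∈ S, ‖w a‖ ^ 2) :
    ∃ κ : ℝ, 0 < κ ∧ ∃ p₁ : ℕ, ∀ (p : ℕ) [Fact p.Prime], p₁ ≤ p →
      ∀ (Q : Finset ℕ), (∀ a ∈ Q, a < p) →
        (∀ a ∈ Q, ∀ b ∈ Q, a ≠ b → legendreSym p ((a : ℤ) + b) = 1) →
        (Q.card : ℝ) ≤ (p : ℝ) ^ (1 / 2 - κ) + 2 := by
  classical
  obtain ⟨κ₀, hκ₀, δ₁, hδ₁, p₁, hB⟩ := hB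
  -- shrink `κ` to `κ = min κ₀ (1/2)` so that `p^{1/2-κ} ≥ 1`
  set κ : ℝ := min κ₀ (1 / 2) with hκdef
  have hκ : 0 < κ := lt_min hκ₀ (by norm_num)
  have hκle : κ ≤ κ₀ := min_le_left _ _
  have hκhalf : κ ≤ 1 / 2 := min_le_right _ _
  obtain ⟨N, hN⟩ : ∃ N : ℕ, (4 : ℝ) ^ (1 / (δ₁ + κ)) ≤ (N : ℝ) := ⟨_, Nat.le_ceil _⟩
  refine ⟨κ, hκ, max p₁ N, ?_⟩
  intro p _ hp Q hQp hQ
  have hprime : p.Prime := Fact.out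
  have hp0 : (0 : ℝ) < (p : ℝ) := by exact_mod_cast hprime.pos
  have hp1 : (1 : ℝ) ≤ (p : ℝ) := by exact_mod_cast hprime.one_lt.le
  have hp₁ : p₁ ≤ p := le_trans (le_max_left _ _) hp
  have hpN : (N : ℝ) ≤ (p : ℝ) := by exact_mod_cast le_trans (le_max_right _ _) hp
  have h4 : (4 : ℝ) ≤ (p : ℝ) ^ (δ₁ + κ) := by
    have h0 : (0 : ℝ) ≤ (4 : ℝ) ^ (1 / (δ₁ + κ)) := Real.rpow_nonneg (by norm_num) _
    calc (4 : ℝ) = ((4 : ℝ) ^ (1 / (δ₁ + κ))) ^ (δ₁ + κ) := by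
          rw [one_div, Real.rpow_inv_rpow (by norm_num) (by positivity)]
      _ ≤ (p : ℝ) ^ (δ₁ + κ) := Real.rpow_le_rpow h0 (hN.trans hpN) (by positivity)
  have hθ1 : (1 : ℝ) ≤ (p : ℝ) ^ (1 / 2 - κ) := Real.one_le_rpow hp1 (by linarith)
  have hθmono : (p : ℝ) ^ (1 / 2 - κ₀) ≤ (p : ℝ) ^ (1 / 2 - κ) :=
    Real.rpow_le_rpow_of_exponent_le hp1 (by linarith)
  -- Step A: small sum-cliques
  have stepA : ∀ Q' : Finset ℕ, (∀ a ∈ Q', a < p) →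
      (∀ a ∈ Q', ∀ b ∈ Q', a ≠ b → legendreSym p ((a : ℤ) + b) = 1) →
      (Q'.card : ℝ) ≤ (p : ℝ) ^ (1 / 2 + δ₁) → (Q'.card : ℝ) ≤ (p : ℝ) ^ (1 / 2 - κ) + 2 := by
    intro Q' hQ'p hQ' hQ'c
    have hw := hB p hp₁ Q' hQ'p hQ'c (fun _ => (1 : ℂ))
    have hform : paleyForm p Q' (fun _ => (1 : ℂ)) =
        ((∑ a ∈ Q', ∑ b ∈ Q', legendreSym p ((a : ℤ) + b) : ℤ) : ℂ) := by
      unfold paleyForm; push_cast; simp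
    have hnw : ∑ a ∈ Q', ‖(fun _ : ℕ => (1 : ℂ)) a‖ ^ 2 = (Q'.card : ℝ) := by simp
    rw [hform, hnw, Complex.norm_intCast] at hw
    have hlow := sumClique_charSum_ge p Q' hQ'
    have hlowR : ((Q'.card : ℝ) ^ 2 - 2 * Q'.card) ≤
        |((∑ a ∈ Q', ∑ b ∈ Q', legendreSym p ((a : ℤ) + b) : ℤ) : ℝ)| := by
      refine le_trans ?_ (le_abs_self _)
      exact_mod_cast hlow
    have hmain : (Q'.card : ℝ) ^ 2 - 2 * Q'.card ≤ (p : ℝ) ^ (1 / 2 - κ) * Q'.card :=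
      hlowR.trans (hw.trans (mul_le_mul_of_nonneg_right hθmono (Nat.cast_nonneg _)))
    rcases Nat.eq_zero_or_pos Q'.card with h0 | hpos
    · rw [h0]; push_cast; linarith
    · have hc : (0 : ℝ) < Q'.card := by exact_mod_cast hpos
      have : (Q'.card : ℝ) - 2 ≤ (p : ℝ) ^ (1 / 2 - κ) := by
        by_contra hlt
        push Not at hlt
        nlinarith
      linarith
  -- Step B: a large clique contains a `⌊p^{1/2+δ₁}⌋`-sub-clique, contradicting Step A
  by_cases hsmall : (Q.card : ℝ) ≤ (p : ℝ) ^ (1 / 2 + δ₁)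
  · exact stepA Q hQp hQ hsmall
  · exfalso
    push Not at hsmall
    set n : ℕ := ⌊(p : ℝ) ^ (1 / 2 + δ₁)⌋₊ with hndef
    have hKnn : 0 ≤ (p : ℝ) ^ (1 / 2 + δ₁) := Real.rpow_nonneg hp0.le _
    have hnle : (n : ℝ) ≤ (p : ℝ) ^ (1 / 2 + δ₁) := Nat.floor_le hKnn
    have hnlt : (p : ℝ) ^ (1 / 2 + δ₁) < (n : ℝ) + 1 := Nat.lt_floor_add_one _
    have hnQ : n ≤ Q.card := by exact_mod_cast (hnle.trans hsmall.le)
    obtain ⟨Q', hQ'sub, hQ'card⟩ := exists_subset_card_eq hnQ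
    have hA := stepA Q' (fun a ha => hQp a (hQ'sub ha))
      (fun a ha b hb hab => hQ a (hQ'sub ha) b (hQ'sub hb) hab) (by rw [hQ'card]; exact hnle)
    rw [hQ'card] at hA
    -- `p^{1/2+δ₁} = p^{1/2-κ} p^{δ₁+κ} ≥ 4 p^{1/2-κ} ≥ p^{1/2-κ} + 3`
    have hsplit : (p : ℝ) ^ (1 / 2 + δ₁) = (p : ℝ) ^ (1 / 2 - κ) * (p : ℝ) ^ (δ₁ + κ) := by
      rw [← Real.rpow_add hp0]; ring_nf
    have hbig : (p : ℝ) ^ (1 / 2 - κ) + 3 ≤ (p : ℝ) ^ (1 / 2 + δ₁) := by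
      rw [hsplit]; nlinarith
    linarith

end Consequences

end

end Summit.ValiantsHypothesis.ValiantsHypothesis.Theorems.FeketeSOSHardPaleyRIP
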